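import Literature.NumberTheory.Automorphic.IsomorphismTheoremUniqueLie
import Literature.NumberTheory.Automorphic.RootSpaceLine
import Literature.NumberTheory.Automorphic.LieCentralizerTorus
import HarnessLib

/-!
# Uniqueness in the isomorphism theorem (Springer 9.6.2) in characteristic `0`: reduction to 7.4.3
(trunk T-AUTOMORPHIC, G25 AutomorphicL; companion of `IsomorphismTheoremUnique.lean`,
`IsomorphismTheoremUniqueProofs.lean`, `IsomorphismTheoremUniqueLie.lean`)

`IsomorphismTheoremUnique.lean` vendors the uniqueness clause of the isomorphism theorem
(Springer, *Linear Algebraic Groups*, 2nd ed., Theorem 9.6.2, second assertion, p. 179) as the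
named fact `isomorphismTheorem_unique`, for a connected reductive `G ≤ GL_n` with maximal torus
`T` over an *arbitrary* algebraically closed field, and `IsomorphismTheoremUniqueProofs.lean`
formalises Springer's proof as the assembly
`isomorphismTheorem_unique_of : exists_isRootDatumOf → rootSubgroup_unique →
torus_sup_rootSubgroups_eq → isomorphismTheorem_unique` (7.4.3, 8.1.1 (i), 8.1.1 (ii)).

Over an algebraically closed field **of characteristic `0`** the last two leaves are theorems of
the tree as soon as `(G, T)` has a root datum, by the Lie-algebra route (`𝔤^T = L(T)`, Springer
5.4.7 with 7.6.4 (ii): `lieWeightSpace_one_le_lieAlgebraGL_of_charZero`, `LieCentralizerTorus.lean`;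
`dim 𝔤_α ≤ 1`, 8.1.2: `finrank_lieWeightSpace_le_one_of_lieWeightSpace_one_le`,
`RootSpaceLine.lean`, which uses the `SL₂` of each root supplied by the datum; `P ⊆ R`, 8.1.2:
`lieWeights_subset_roots`, `LieAlgebraGLNilpotentExp.lean`; whence 8.1.1 (i),
`rootSubgroup_unique_of_lieWeightSpace_one_le`, and 8.1.1 (ii) through 7.1.3 (i),
`torus_sup_rootSubgroups_eq_of_lieWeights_subset`, `IsomorphismTheoremUniqueLie.lean`) — exactly
as in the discharge `IsSplitDual.isSplit_holds` of `DualGroupIsSplitProofs.lean` for the complex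
dual group, whose dual group structure carries its datum. This file records the consequence for a
general `(G, T)` in characteristic `0`: **the three leaves collapse to the single leaf
`exists_isRootDatumOf` (Springer 7.4.3, existence of the root datum)**:

* `rootSubgroup_unique_of_exists_isRootDatumOf` (8.1.1 (i) in characteristic `0` from 7.4.3);
* `finrank_lieWeightSpace_le_one_of_exists_isRootDatumOf` (8.1.2, second clause, likewise);
* `torus_sup_rootSubgroups_eq_of_exists_isRootDatumOf` (8.1.1 (ii) likewise);
* `isomorphismTheorem_unique_of_exists_isRootDatumOf` (**9.6.2, uniqueness, in characteristic
  `0` from 7.4.3 alone**) and `mem_center_iff_forall_roots_of_exists_isRootDatumOf` (8.1.8 (i)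
  from 7.4.3 and 7.6.4 (ii)).

Everything here is proved; no named fact is introduced and no statement of the tree is changed.
The discharge `isomorphismTheorem_unique_holds` itself (all characteristics, as the fact is
stated) remains `isomorphismTheorem_unique_of exists_isRootDatumOf_holds rootSubgroup_unique_holds
torus_sup_rootSubgroups_eq_holds` once those three named facts of the tree are discharged; in
positive characteristic the Lie-algebra route of this file is not available (Springer 4.4.11,
5.4.9), and the printed route is 7.6.4, 7.3.3, 7.1.3 with the general 5.4.7.

## References

* [SpringerLAG1998] T. A. Springer, *Linear Algebraic Groups*, 2nd ed., Progress in Mathematics 9,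
  Birkhäuser (1998): Theorem 9.6.2 and its proof (p. 179), 7.4.3, 8.1.1, Cor. 8.1.2, 8.1.8 (i),
  7.1.3 (i), Cor. 5.4.7, Cor. 7.6.4 (ii).
-/

noncomputable section

open scoped MatrixGroups IsMulCommutative

namespace Literature.NumberTheory.Automorphic

variable {k : Type*} [Field k] {n : Type*} [Fintype n] [DecidableEq n]
variable {n' : Type*} [Fintype n'] [DecidableEq n']
variable {G T : Subgroup (GL n k)}

/-- **Springer 8.1.2 (second clause) in characteristic `0`, from the existence of the root datum
alone:** if `(G, T)` admits a root datum (`exists_isRootDatumOf`, 7.4.3) then every root space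
`𝔤_α`, `α ∈ R(G, T)`, has dimension `≤ 1` — every root is `α_i` for an index `i` of the datum
(`IsRootDatumOf.range_root`), `𝔤^T ⊆ L(T)` holds in characteristic `0`
(`lieWeightSpace_one_le_lieAlgebraGL_of_charZero`, 5.4.7 with 7.6.4 (ii)) and
`finrank_lieWeightSpace_le_one_of_lieWeightSpace_one_le` applies.
[cite: SpringerLAG1998, Cor. 8.1.2] -/
theorem finrank_lieWeightSpace_le_one_of_exists_isRootDatumOf [IsAlgClosed k] [CharZero k]
    (hRD : exists_isRootDatumOf (G := G) (T := T)) (hG : IsConnectedReductive G)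
    (hT : IsMaximalTorusIn T G) {α : ↥(characterLattice T)} (hα : α ∈ roots G T) :
    Module.finrank k ↥(lieWeightSpace G T (α : ↥T →* kˣ)) ≤ 1 := by
  haveI : IsMulCommutative ↥T := hT.2.1.2.1
  obtain ⟨ι, X, Y, _, _, _, P, eX, eY, h, -⟩ := hRD hG hT
  have hmem : eX (Additive.ofMul α) ∈ Set.range P.root := by
    rw [h.range_root]
    exact ⟨α, hα, rfl⟩
  obtain ⟨i, hi⟩ := hmem
  have hαi : charOfWeight eX (P.root i) = (α : ↥T →* kˣ) := by
    simp [charOfWeight, hi]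
  rw [← hαi]
  exact finrank_lieWeightSpace_le_one_of_lieWeightSpace_one_le hG hT
    (lieWeightSpace_one_le_lieAlgebraGL_of_charZero hG hT) h i

/-- **Springer 8.1.1 (i) (`rootSubgroup_unique`) in characteristic `0` from 7.4.3 alone:** over an
algebraically closed field of characteristic `0`, if `(G, T)` admits a root datum then all root
homomorphisms for a root `α` have the same image `U_α`
(`rootSubgroup_unique_of_lieWeightSpace_one_le` with `lieWeightSpace_one_le_lieAlgebraGL_of_charZero`).
[cite: SpringerLAG1998, 8.1.1 (i) and Cor. 8.1.2] -/
theorem rootSubgroup_unique_of_exists_isRootDatumOf [CharZero k]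
    (hRD : exists_isRootDatumOf (G := G) (T := T)) : rootSubgroup_unique (G := G) (T := T) := by
  intro _ hG hT α hα u hu
  haveI : IsMulCommutative ↥T := hT.2.1.2.1
  obtain ⟨ι, X, Y, _, _, _, P, eX, eY, h, -⟩ := hRD hG hT
  exact rootSubgroup_unique_of_lieWeightSpace_one_le hG hT
    (lieWeightSpace_one_le_lieAlgebraGL_of_charZero hG hT) h hG hT hα hu

/-- **Springer 8.1.1 (ii) (`torus_sup_rootSubgroups_eq`) in characteristic `0` from 7.4.3 alone:**
over an algebraically closed field of characteristic `0`, if `(G, T)` admits a root datum then `T`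
and the root subgroups `U_α` (`α ∈ R`) generate `G` — the argument of 7.1.3 (i)
(`torus_sup_rootSubgroups_eq_of_lieWeights_subset`) fed with `P ⊆ R` (`lieWeights_subset_roots`),
`dim 𝔤_α ≤ 1` (`finrank_lieWeightSpace_le_one_of_exists_isRootDatumOf`) and `𝔤^T ⊆ L(T)`
(`lieWeightSpace_one_le_lieAlgebraGL_of_charZero`).
[cite: SpringerLAG1998, 8.1.1 (ii) with 7.1.3 (i), 8.1.2, 5.4.7] -/
theorem torus_sup_rootSubgroups_eq_of_exists_isRootDatumOf [CharZero k]
    (hRD : exists_isRootDatumOf (G := G) (T := T)) :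
    torus_sup_rootSubgroups_eq (G := G) (T := T) := by
  intro _ hG hT
  exact torus_sup_rootSubgroups_eq_of_lieWeights_subset hG.1 hT.2.1 hT.1
    (lieWeights_subset_roots hG.2.1 hT.2.1.1 hT.1)
    (fun α hα => finrank_lieWeightSpace_le_one_of_exists_isRootDatumOf hRD hG hT hα)
    (lieWeightSpace_one_le_lieAlgebraGL_of_charZero hG hT)

/-- **Uniqueness in the isomorphism theorem (Springer 9.6.2, second assertion) in characteristic
`0`, from the existence of the root datum (7.4.3) alone.** Over an algebraically closed field of
characteristic `0`: if `(G, T)` admits a root datum then two isomorphisms of algebraic groups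
`φ, φ' : G → G₁` mapping `T` onto `T₁` and inducing the same map `X*(T₁) → X*(T)` differ by
`Int(t)`, `t ∈ T` — Springer's proof (`isomorphismTheorem_unique_of`) with its inputs 8.1.1 (i)
and 8.1.1 (ii) supplied by `rootSubgroup_unique_of_exists_isRootDatumOf` and
`torus_sup_rootSubgroups_eq_of_exists_isRootDatumOf`. [cite: SpringerLAG1998, Thm. 9.6.2] -/
theorem isomorphismTheorem_unique_of_exists_isRootDatumOf [CharZero k] {G₁ T₁ : Subgroup (GL n' k)}
    (hRD : exists_isRootDatumOf (G := G) (T := T)) :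
    isomorphismTheorem_unique (G := G) (T := T) (G₁ := G₁) (T₁ := T₁) :=
  isomorphismTheorem_unique_of hRD (rootSubgroup_unique_of_exists_isRootDatumOf hRD)
    (torus_sup_rootSubgroups_eq_of_exists_isRootDatumOf hRD)

/-- The case `G₁ = G`, `φ = id` in characteristic `0` from 7.4.3 alone: an automorphism `θ` of the
algebraic group `G` with `θ T = T` inducing the identity on `X*(T)` is `Int(t)` for some `t ∈ T`
(`isomorphismTheorem_unique.mulEquiv_eq_conj`). [cite: SpringerLAG1998, Thm. 9.6.2 (proof)] -/
theorem mulEquiv_eq_conj_of_exists_isRootDatumOf [IsAlgClosed k] [CharZero k]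
    (hRD : exists_isRootDatumOf (G := G) (T := T)) (hG : IsConnectedReductive G)
    (hT : IsMaximalTorusIn T G) (θ : ↥G ≃* ↥G)
    (hθ : MonoidHom.IsAlgebraicGL (G.subtype.comp θ.toMonoidHom))
    (hθ' : MonoidHom.IsAlgebraicGL (G.subtype.comp θ.symm.toMonoidHom))
    (hθT : ∀ g : ↥G, ((θ g : ↥G) : GL n k) ∈ T ↔ (g : GL n k) ∈ T)
    (hχ : ∀ χ : ↥T →* kˣ, IsAlgebraicChar χ → ∀ (g : ↥G) (hg : (g : GL n k) ∈ T),
      χ ⟨((θ g : ↥G) : GL n k), (hθT g).mpr hg⟩ = χ ⟨(g : GL n k), hg⟩) :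
    ∃ t : ↥G, (t : GL n k) ∈ T ∧ ∀ g : ↥G, θ g = t * g * t⁻¹ :=
  isomorphismTheorem_unique.mulEquiv_eq_conj
    (isomorphismTheorem_unique_of_exists_isRootDatumOf (G₁ := G) (T₁ := T) hRD) hG hT θ hθ hθ' hθT
    hχ

/-- **Springer 8.1.8 (i) (`mem_center_iff_forall_roots`: `C(G) = ⋂_{α ∈ R} Ker α`) in
characteristic `0` from 7.4.3 and 7.6.4 (ii):** the printed proof
(`mem_center_iff_forall_roots_of`) with 8.1.1 (ii) supplied by
`torus_sup_rootSubgroups_eq_of_exists_isRootDatumOf`; `Z_G(T) = T`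
(`centralizer_eq_of_isMaximalTorusIn`, 7.6.4 (ii)) remains a hypothesis.
[cite: SpringerLAG1998, Prop. 8.1.8 (i)] -/
theorem mem_center_iff_forall_roots_of_exists_isRootDatumOf [CharZero k]
    (h₁ : centralizer_eq_of_isMaximalTorusIn (k := k) (n := n))
    (hRD : exists_isRootDatumOf (G := G) (T := T)) :
    mem_center_iff_forall_roots (G := G) (T := T) :=
  mem_center_iff_forall_roots_of h₁ (torus_sup_rootSubgroups_eq_of_exists_isRootDatumOf hRD)

end Literature.NumberTheory.Automorphic

end
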